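import Literature.NumberTheory.LFunctions.TatuzawaTheorem
import Literature.NumberTheory.DiophantineGeometry.AbcWave0GranvilleStarkEq11Proofs
import HarnessLib

/-!
# Tatuzawa's theorem in class-number form: `h(−d) ≥ (C_T/π) ε³ d^{1/2−ε}` with at most one exception
# (Oesterlé 1988, II §4, display (30) — in the tree's explicit constant)

Topic `NumberTheory/QuadraticFields`, namespace `Literature.NumberTheory.QuadraticFields.BinaryQuadraticForm`
(beside `SiegelClassNumberLowerBound.lean`). Everything here is PROVED (theorems only; no
definitions, no named facts).

J. Oesterlé, *Le problème de Gauss sur le nombre de classes*, Enseign. Math. (2) 34 (1988) 43–67,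
II §4, p. 60 (page image `HOME/goldfeld/lit-scans/oesterle1988-p60.jpg`):

> «Signalons toutefois le joli résultat suivant, dû à Tatuzawa ¹): si 0 < ε < 1/2, on a
> (30) h(−d) ≥ (0,655/π) ε d^{1/2−ε} pour d > sup(e^{1/ε}, e^{11,2}) à au plus une exception près.»
> ¹) T. Tatuzawa, On a theorem of Siegel, Jap. J. of Math. 21 (1951) 163–178.

The tree proves Tatuzawa's theorem in the `L(1, χ)` form with its OWN explicit constant
(`Literature.NumberTheory.LFunctions.Siegel.tatuzawa_atMostOne_modulus`, [Tatuzawa1951, Thm 2] via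
Montgomery–Vaughan §11.2: for `0 < ε ≤ 1` there is `q₀` with
`Re L(1, χ) ≥ C_T ε³ q^{−ε}`, `C_T = estermannC/(2592 · ballConst)`, for every primitive quadratic
`χ ≠ 1` mod `q ≠ q₀`). This file assembles the CLASS-NUMBER FORM of that statement with Dirichlet's
class number formula `L(1, χ) = π h(−d)/√d` (`d > 4`, `χ` the odd real primitive character mod `d`,
i.e. `−d` a fundamental discriminant `< −4`; `Literature.NumberTheory.DiophantineGeometry.LFunction_one_eq`):

* `tatuzawa_classNumber_neg_ge` — **for `0 < ε ≤ 1` there is `d₀` such that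
  `(C_T/π) ε³ d^{1/2−ε} ≤ h(−d)` for every `d > 4`, `d ≠ d₀`, carrying an odd real primitive character
  mod `d`** (`h(−d)` = `classNumber (−d)`, the number of reduced primitive forms): Tatuzawa's
  «à au plus une exception près», effective apart from the one exceptional `d₀`.

NOT the printed constant: Oesterlé's display (30) (Tatuzawa's own) has `(0,655/π) ε d^{1/2−ε}` for
`d > max(e^{1/ε}, e^{11,2})`; the tree's constant `C_T ε³` is weaker (and has no lower threshold on
`d`). The sharper printed constant is not reproduced here (`-- TODO(as printed): 0.655 ε/π, d > e^{1/ε}`).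

## References

* [Oesterle1988Gauss] J. Oesterlé, Enseign. Math. (2) 34 (1988), II §4 (30) p. 60.
* [Tatuzawa1951] T. Tatuzawa, *On a theorem of Siegel*, Jap. J. Math. 21 (1951) 163–178, Theorem 2.
* [MontgomeryVaughan2007] H. L. Montgomery, R. C. Vaughan, *Multiplicative Number Theory I*, §11.2.
-/

noncomputable section

open Complex

namespace Literature.NumberTheory.QuadraticFields

open Literature.NumberTheory.LFunctions.Estermann (estermannC)
open Literature.NumberTheory.LFunctions.Siegel (tatuzawa_atMostOne_modulus ballConst)

namespace BinaryQuadraticForm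

/-- **Tatuzawa's theorem, class-number form (Oesterlé 1988, II §4 (30), in the tree's constant):**
for `0 < ε ≤ 1` there is a natural number `d₀` (the possible exception) such that for every `d > 4`
with `d ≠ d₀` carrying an odd real primitive character `χ mod d` (`−d` fundamental),
`(C_T/π) · ε³ · d^{1/2−ε} ≤ h(−d)`, `C_T = estermannC/(2592 · ballConst)` — «à au plus une exception
près». From `Re L(1, χ) ≥ C_T ε³ d^{−ε}` (`tatuzawa_atMostOne_modulus`) and `L(1, χ) = π h(−d)/√d`.
The printed constant `0,655 ε/π` (for `d > max(e^{1/ε}, e^{11,2})`) is Tatuzawa's sharper one and is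
not claimed. [cite: Oesterle1988Gauss, II §4 (30) p. 60] [cite: Tatuzawa1951, Theorem 2] -/
theorem tatuzawa_classNumber_neg_ge {ε : ℝ} (hε : 0 < ε) (hε1 : ε ≤ 1) :
    ∃ d₀ : ℕ, ∀ (d : ℕ) [NeZero d], 4 < d → d ≠ d₀ → ∀ χ : DirichletCharacter ℂ d,
      χ.IsPrimitive → χ.IsQuadratic → χ.Odd →
        estermannC / (2592 * ballConst) / Real.pi * ε ^ 3 * (d : ℝ) ^ (1 / 2 - ε) ≤
          (classNumber (-(d : ℤ)) : ℝ) := by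
  obtain ⟨q₀, hT⟩ := tatuzawa_atMostOne_modulus hε hε1
  refine ⟨q₀, ?_⟩
  intro d _ hd hne χ hprim hquad hodd
  have hd0 : (0 : ℝ) < d := by exact_mod_cast (by omega : 0 < d)
  have hχ1 : χ ≠ 1 := by
    intro h
    have h1 : χ (-1) = -1 := hodd
    rw [h, MulChar.one_apply isUnit_one.neg] at h1
    norm_num at h1
  have hTχ := hT d χ hquad.sq_eq_one hprim hχ1 hne
  rw [Literature.NumberTheory.DiophantineGeometry.LFunction_one_eq hd hprim hquad hodd,
    Complex.ofReal_re] at hTχ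
  -- `C ε³ d^{−ε} ≤ π h/√d` ⇒ `C ε³ d^{−ε} √d ≤ π h`
  rw [le_div_iff₀ (Real.sqrt_pos.2 hd0)] at hTχ
  have hπ := Real.pi_pos
  have hsplit : (d : ℝ) ^ (1 / 2 - ε) = (d : ℝ) ^ (-ε) * Real.sqrt d := by
    rw [Real.sqrt_eq_rpow, ← Real.rpow_add hd0]; ring_nf
  rw [hsplit]
  calc estermannC / (2592 * ballConst) / Real.pi * ε ^ 3 * ((d : ℝ) ^ (-ε) * Real.sqrt d)
      = (estermannC / (2592 * ballConst) * ε ^ 3 * (d : ℝ) ^ (-ε) * Real.sqrt d) / Real.pi := by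
        field_simp
    _ ≤ (Real.pi * classNumber (-(d : ℤ))) / Real.pi := by gcongr
    _ = classNumber (-(d : ℤ)) := by field_simp

end BinaryQuadraticForm

end Literature.NumberTheory.QuadraticFields

end
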